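import Literature.NumberTheory.LFunctions.AlternativeHypothesisTheorem3Assembly
import Literature.NumberTheory.LFunctions.AlternativeHypothesisLemma6UniformProofs
import HarnessLib

/-!
# BGSTB 2025, Theorem 3 — the typed claim `bgstb2025_theorem3` DISCHARGED

Topic `Literature/NumberTheory/LFunctions` (namespace `Literature.NumberTheory.LFunctions`). PROOF
LAYER, one theorem, cell `rh-crit/ah` (C5). LABEL: **NOT RH-BEARING** — `bgstb2025_theorem3` is the
CONDITIONAL `RiemannHypothesis → AHPairs → …` of an unrefereed preprint (arXiv:2508.10857, Theorem 3,
as typed in `AlternativeHypothesisFormFactor.lean`); proving the conditional says nothing about RH or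
about AH-Pairs, and nothing here bears on the truth of RH.

The composition `bgstb2025_theorem3_of_windows` (seat t2, `AlternativeHypothesisTheorem3Assembly`)
reduces the typed Theorem 3 to four M-free window limits under RH and AH-Pairs; these are the tree
theorems `AH.window_nonint_limit`, `AH.window_even_limit`, `AH.window_odd_limit`,
`AH.window_one_limit` (seat t5, `AlternativeHypothesisLemma6UniformProofs`, from Lemma 5 (iii)–(iv)
with M-uniform constants, Corollary 5 and the sound two-sided Lemma 6). This file only plugs them in.

## References

* [BaluyotGoldstonSuriajayaTurnageButterbaugh2025] arXiv:2508.10857, Theorem 3 and §7 (proof of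
  Theorem 3), held text `paper:arxiv-2508.10857` p0004, p0016.
-/

noncomputable section

namespace Literature.NumberTheory.LFunctions

/-- **BGSTB 2025, Theorem 3 AS TYPED (`bgstb2025_theorem3`) — PROVED, from the RH and AH-Pairs
hypotheses INSIDE the statement as printed**: "Assuming the Riemann Hypothesis and AH-Pairs, we have
as `T → ∞` that `∫_a^b F(α) g(α) dα = ∫_a^b 𝓕(α) g(α) dα + o(1)`" (for every admissible `[a, b]`
and test function `g` of the typed statement). Composition of `bgstb2025_theorem3_of_windows` (seat
t2 g3, p461436) with the window limits `AH.window_nonint_limit`, `AH.window_even_limit`,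
`AH.window_odd_limit`, `AH.window_one_limit` (seat t5 g4, p464596). RH and AH-Pairs are the
antecedents of the statement proved; nothing is asserted about either.
[cite: BaluyotGoldstonSuriajayaTurnageButterbaugh2025, Theorem 3] -/
theorem bgstb2025_theorem3_holds : bgstb2025_theorem3 :=
  bgstb2025_theorem3_of_windows fun hRH hAH ↦
    ⟨fun K _ hε ↦ AH.window_nonint_limit hRH hAH K hε,
     fun L _ _ hε ↦ AH.window_even_limit hRH hAH L hε,
     fun K hK _ _ hδ hδ2 _ hM _ hε ↦ AH.window_odd_limit hRH hAH K hK hδ hδ2 hM hε,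
     fun _ hδ hδ2 _ hM _ hε ↦ AH.window_one_limit hRH hAH hδ hδ2 hM hε⟩

end Literature.NumberTheory.LFunctions

end
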